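import Summits.QuantumFields.YangMills.Theorems.UnitScaleTiltProp7TJWeightedRowsOfUnweighted
import Summits.QuantumFields.YangMills.Theorems.UnitScaleTiltProp7TJRowOfEntry157
import Summits.QuantumFields.YangMills.Theorems.UnitScaleTiltProp7CovKernel157Member
import Summits.QuantumFields.YangMills.Theorems.UnitScaleTiltProp7ColumnRowsOfKernelDecay
import HarnessLib

/-!
# Route `UnitScaleTilt`, crux K1 «MinimiserStabilityRegPr» (stmt-QuantumFields-19200), EX rows `norm_G`∕`norm_H₁`∕`hCk` (J-slot) — FILE (T-FAM):
# **THE ROWS OF PRINT'S J-TERM `T_Jᴾ(U₀)` FOR ALL MEMBERS FROM THE ROW `h133` OF `H_π`** — the sup row (linear in the regularity radius, K-free), E1∕E2's weighted and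
# block-supported letters (Tw)(TDw)∕(Tb)(TDb) at EVERY rate, as ONE L-only family in the K-storey thread `RegPr ρ U₀ → ρ ≤ α L → Lift → ROOM → a ∈ window`

Cell `ym3-torus` (HUMAN RULING D-0037; rung R3 = SU(2) YM₃ on T³ — NOT d = 4, NOT infinite volume, NOT a mass gap, NOT Clay).  Width seat `ym3-torus-px12` (gen 18; px10 g14 «(T-FAM): GO»
2026-08-30 13:51Z).  THEOREMS ONLY (0 `def`, 0 `sorry`, default heartbeats); `--supports stmt-QuantumFields-19200 --as helper`; count-neutral.

THE MATHEMATICS (member-level chain, every link LANDED).  At a member `U₀ ∈ 𝔘_k(ρ)` with the Π-slot kernel row `h133` «`‖H̃ᴾ(δ_yZ)(b′)‖ ≤ CH·e^{−(δH∕2)·d}·‖Z‖`»: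
✓`Prop7ColumnRowsOfKernelDecay.column_row_of_kernel_decay` gives the `ℓ¹`-column majorant (`Θ = 3CH(2(1+2∕δH))³ℓ³`); the (157) entry row of the chart remainder is a THEOREM
(F-5a ✓`Prop7CovKernel157Member.norm_fderiv_CmapTwS_apply_le_of_regPr`, `g′ = 10¹¹L⁵ℓ⁻¹`, windows `10¹¹L⁶e ≤ 1`, `10¹⁶L⁵ρ ≤ 1`) and feeds the local Hessian column
✓`Prop7TJRowOfEntry157.sum_norm_avgHess_single_le_of_entry_row` (`q = 6g′`); ✓`Prop7TJRowOfColumns.tjRow_of_regPr_column` then gives the sup row of `T_Jᴾ` with constant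
`2ρ·Θ·q·η² = ρ·36·10¹¹L⁵·CH·(2(1+2∕δH))³` — LINEAR IN `ρ`, K-FREE (`ℓ³·ℓ⁻¹·η² = 1`).  `T_Jᴾ` is local (px19 FILE 9 ✓`Prop7TJWeightedRowsOfUnweighted`): §2 there turns the sup row into
E1's weighted value letter (Tw) at every rate `δ` (constant `×e^{δ}`), §4 there gives the weighted divergence letter (TDw) from the column majorant and the DISPLAYED gauge-spike Hessian
row `hqG` (px19's (q-gauge) programme, supplier ✓`Prop7AvgHessGaugeIdentityNormReading.hqG_of_pointwise_identity_and_FR2_family` modulo ⟨(2), FR₂-lite⟩), constant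
`2ρ·Θ·(qG·ℓ⁻¹)·η²·e^{δ} = ρ·6CH(2(1+2∕δH))³·qG·e^{δ}`; and a block-supported source of sup `s` IS a weighted source with `m = s` (§0), so (Tb)(TDb) follow at the same constants.

WHAT IS PROVED (ns `Summit.QuantumFields.YangMills.Theorems.Prop7TJRowsFamilyOfH133`).
* §0 ★ `blockLetter_of_weightedLetter` — a weighted letter at rate `δ ≥ 0` implies the block-supported letter at rate `δ` (same constant).
* §1 ★★★ `tjSupRow_of_h133` — MEMBER: `h133` at the member ⟹ the sup row of `T_Jᴾ … a U₀`, constant `ρ·(36·10¹¹L⁵·CH·(2(1+2∕δH))³)`.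
* §2 ★★★ `tjValueRows_family_of_h133` — FAMILY (K-storey thread, L-only) FROM `h133` ALONE: GIVEN px10's ✓`h133_family_exists` member block VERBATIM (letters `αH CH δH`), THERE ARE
  `αT MT : ℕ → ℝ` (cap with the four windows `10¹²L³`, `10¹⁰L⁶`, `13·10¹⁴L³`, `10¹⁶L⁵`, `≤ αH`, `≤ 1`; `0 ≤ MT`) such that at every member under
  `RegPr ρ U₀ → ρ ≤ αT L → Lift → ROOM → a ∈ [a₀,a₁]·(c₀ L∕cB L)ℓ³`: (T-sup-lin) the sup row with constant `ρ′·MT L` for every radius `0 ≤ ρ′ ≤ αT L` with `RegPr ρ′ U₀`;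
  (Tw-lin)∕(Tb-lin) E1's weighted ∕ E2's block value letter at EVERY rate `δ ≥ 0` and radius `0 < ρ′ ≤ αT L`, constant `ρ′·MT L·e^{δ}` (linear in the radius).
* §2 ★★★ `tjDivRows_family_of_h133_hqG` — FAMILY FROM `h133` AND px19's DISPLAYED `hqG` family (letters `αq qG`): `αD MD` with (TDw-lin)∕(TDb-lin), constant `ρ′·MD L·e^{δ}`.
HONEST SCOPE.  Bookkeeping over landed member theorems; CONDITIONAL on the displayed `h133` family (px10 ⧗`h133_family_exists`) and `hqG` family (px19's programme); nothing of `h133`,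
`hqG`, `hKinv`(Δ₁), `norm_H₁`, `hCk`, EX or the crux is proved; no summit is proved by a helper; the Yang–Mills mass gap is NOT proved.

References: T. Bałaban, CMP **99** (1985) 389–434 [Balaban1985BackgroundPropagators] ((3.127)–(3.128) p.421, (3.133) p.422, (3.136)–(3.137) pp.422–423, (3.13)–(3.14) pp.392–393,
(3.114)–(3.115) p.418); CMP **98** (1985) 17–51 [Balaban1985Averaging] (Prop. 5 (157) p.42, (110) p.34); CMP **102** (1985) 277–309 [Balaban1985Variational] ((27)–(28) p.282, (72)–(73) p.289).
-/

set_option autoImplicit false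

noncomputable section

open scoped InnerProductSpace ComplexConjugate Matrix.Norms.L2Operator BigOperators

namespace Summit.QuantumFields.YangMills.Theorems.Prop7TJRowsFamilyOfH133

open Literature.MathematicalPhysics.QuantumFieldTheory.Balaban1983to89
open Literature.MathematicalPhysics.QuantumFieldTheory.Balaban1983to89.T3ContinuumYM3Torus
open Literature.MathematicalPhysics.QuantumFieldTheory.Balaban1983to89.T3Thm1Carrier (Idx)
open T3SectALandauChart (eta eta_pos bgUnits)
open T3PrintedRegularMinimiser (RegPr)
open T3PrintedMinimiserExistence (regPr_mono)
open T3PrintedRegularOrbits (sites_eq)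
open T3LevelShift (siteShift)
open B15DeterminingSets (embIter)
open B9SectCLatticeCarrier (Bond)
open B11Eq103H1Complex (BondL2K)
open B11Eq90V0primeCurrent (flat115)
open B5Eq118OneStroke (iterBlockOf)
open B3Taylor310LocalRemainder (tdist_self)
open Summit.QuantumFields.YangMills.Theorems.Prop8Chart (emlIterU)
open Summit.QuantumFields.YangMills.Theorems.Prop7SectET3Transport (periodsT3 bondEquiv)
open Summit.QuantumFields.YangMills.Theorems.Prop7SectET3HilbertLetters (W₂ toL2 toL2S DL2 DstarL2)
open Summit.QuantumFields.YangMills.Theorems.Prop7SectET3CurvedPropagators (H1f)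
open Summit.QuantumFields.YangMills.Theorems.Prop7SectET3DeltaPiPInv (DeltaPiSlotP)
open Summit.QuantumFields.YangMills.Theorems.Prop7SectET3DeltaOne (avgHess)
open Summit.QuantumFields.YangMills.Theorems.Prop7SectET3DeltaOnePInv (TJSlotP)
open Summit.QuantumFields.YangMills.Theorems.Prop7SymAvgTwSym (CmapTwS)
open Summit.QuantumFields.YangMills.Theorems.Prop7ColumnRowsOfKernelDecay (column_row_of_kernel_decay)
open Summit.QuantumFields.YangMills.Theorems.Prop7CovKernel157Member (norm_fderiv_CmapTwS_apply_le_of_regPr)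
open Summit.QuantumFields.YangMills.Theorems.Prop7TJRowOfEntry157 (sum_norm_avgHess_single_le_of_entry_row)
open Summit.QuantumFields.YangMills.Theorems.Prop7TJRowOfColumns (tjRow_of_regPr_column)
open Summit.QuantumFields.YangMills.Theorems.Prop7TJWeightedRowsOfUnweighted (hTw_of_supRow hTDw_of_regPr_column)

/-! ## §0 A block-supported source is a weighted source -/
/-- ★ **A WEIGHTED LETTER IMPLIES THE BLOCK-SUPPORTED LETTER AT THE SAME RATE AND CONSTANT**: if a reader `Φ` maps every source `Y` with `‖Y i‖ ≤ m·e^{−δ·d(B i, z)}` to an output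
with `‖Φ Y k‖ ≤ C·m·e^{−δ·d(B′ k, z)}`, then for `X` supported on block `z` with `‖X i‖ ≤ s` one has `‖Φ X k‖ ≤ s·C·e^{−δ·d(B′ k, z)}` (on the support `d(B i, z) = 0`). [folklore] -/
theorem blockLetter_of_weightedLetter {P : Params} {k : ℕ} {ι κ V W : Type*} [SeminormedAddCommGroup V] [SeminormedAddCommGroup W]
    (B : ι → Site P k) (B' : κ → Site P k) (Φ : (ι → V) → κ → W) {C δ : ℝ}
    (hw : ∀ (z : Site P k) (Y : ι → V) (m : ℝ), 0 ≤ m → (∀ i, ‖Y i‖ ≤ m * Real.exp (-(δ * (Site.tdist (B i) z : ℝ)))) →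
      ∀ k', ‖Φ Y k'‖ ≤ C * m * Real.exp (-(δ * (Site.tdist (B' k') z : ℝ)))) :
    ∀ (X : ι → V) (z : Site P k), (∀ i, X i ≠ 0 → B i = z) → ∀ s : ℝ, 0 ≤ s → (∀ i, ‖X i‖ ≤ s) →
      ∀ k', ‖Φ X k'‖ ≤ s * C * Real.exp (-(δ * (Site.tdist (B' k') z : ℝ))) := by
  intro X z hXz s hs hX k'
  have hY : ∀ i, ‖X i‖ ≤ s * Real.exp (-(δ * (Site.tdist (B i) z : ℝ))) := by
    intro i
    by_cases hi : X i = 0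
    · rw [hi, norm_zero]; positivity
    · rw [hXz i hi, tdist_self, Nat.cast_zero, mul_zero, neg_zero, Real.exp_zero, mul_one]; exact hX i
  calc ‖Φ X k'‖ ≤ C * s * Real.exp (-(δ * (Site.tdist (B' k') z : ℝ))) := hw z X s hs hY k'
    _ = s * C * Real.exp (-(δ * (Site.tdist (B' k') z : ℝ))) := by ring

/-! ## §1 The member: the sup row of `T_Jᴾ` from `h133` -/
section Member

variable (F : T3Family) {n K : ℕ} (hnK : n < K) (c₀ cB a : ℝ) [Fact (0 < c₀)] [Fact (0 < cB)]

/-- ★★★ **THE SUP ROW OF PRINT'S J-TERM FROM THE ROW `h133`, AT A MEMBER** — `U₀ ∈ 𝔘_k(ρ)` (`RegPr`, `0 < ρ`, windows `10¹²L³ρ ≤ 1`, `10¹⁶L⁵ρ ≤ 1`), the Π-slot kernel row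
`‖flat115 (H̃ᴾ_a(U₀)(δ_yZ)) b′‖ ≤ CH·e^{−(δH∕2)·tdist(B(b′₋), ŷ)}·‖Z‖` (`0 ≤ CH`, `0 < δH`) ⟹ `‖toL2⁻¹(T_Jᴾ_a(U₀)(toL2 X))(bd)‖ ≤ ρ·(36·10¹¹L⁵·CH·(2(1+2∕δH))³)·sup‖X‖`:
column majorant ✓`column_row_of_kernel_decay`, (157) ✓`norm_fderiv_CmapTwS_apply_le_of_regPr` at `e := (10¹¹L⁶)⁻¹`, local Hessian column ✓`sum_norm_avgHess_single_le_of_entry_row`,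
duality ✓`tjRow_of_regPr_column`; dimension line `2ρ·(3CH·V·ℓ³)·(6·10¹¹L⁵·ℓ⁻¹)·η² = 36·10¹¹L⁵·ρ·CH·V`.
[cite: Balaban1985BackgroundPropagators, (3.137) p.423, (3.127)–(3.128) p.421, (3.133) p.422, (3.14) p.393; Balaban1985Averaging, Prop. 5 (157) p.42; Balaban1985Variational, (27)–(28) p.282] -/
theorem tjSupRow_of_h133 [Fact (0 < (F.L : ℝ))] [Fact (0 < ((F.L : ℝ)⁻¹) ^ (K - n))] {ρ : ℝ} (hρ : 0 < ρ) (hW12 : 10 ^ 12 * (F.L : ℝ) ^ 3 * ρ ≤ 1) (hW16 : 10 ^ 16 * (F.L : ℝ) ^ 5 * ρ ≤ 1)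
    (U₀ : GaugeField (F.P K) 0 (Matrix.specialUnitaryGroup (Fin 2) ℂ)) (hreg : RegPr F n K ρ U₀) {CH δH : ℝ} (hCH : 0 ≤ CH) (hδH : 0 < δH)
    (h133 : ∀ (y : PBond (F.P n) 0) (Z : Matrix (Fin 2) (Fin 2) ℂ) (b' : Bond 3 (periodsT3 F K)),
      ‖flat115 ((H1f F n K hnK.le c₀ cB a (DeltaPiSlotP F n K hnK.le c₀ cB a) U₀) (Pi.single y Z)) b'‖
        ≤ CH * Real.exp (-(δH / 2 * (Site.tdist (iterBlockOf (K - n) ((bondEquiv F K).symm b').src) (siteShift (sites_eq F n K hnK.le) y.src) : ℝ))) * ‖Z‖) :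
    ∀ (X : PBond (F.P K) 0 → Matrix (Fin 2) (Fin 2) ℂ) (s : ℝ), (∀ bd, ‖X bd‖ ≤ s) →
      ∀ bd : PBond (F.P K) 0, ‖(toL2 F K c₀).symm (TJSlotP F n K hnK.le c₀ cB a U₀ (toL2 F K c₀ X)) bd‖
        ≤ (ρ * (36 * 10 ^ 11 * (F.L : ℝ) ^ 5 * CH * (2 * (1 + 2 / δH)) ^ 3)) * s := by
  intro X s hX bd
  have hL1 : (1 : ℝ) < (F.L : ℝ) := by exact_mod_cast F.hL.2
  have hL0 : (0 : ℝ) < (F.L : ℝ) := lt_trans zero_lt_one hL1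
  have hℓ : (0 : ℝ) < (F.L : ℝ) ^ (K - n) := pow_pos hL0 _
  -- the column majorant of `h133`
  obtain ⟨hk, -, hcol, hsum⟩ := column_row_of_kernel_decay F n K hnK.le
    (fun (y : PBond (F.P n) 0) (Z : Matrix (Fin 2) (Fin 2) ℂ) (b' : Bond 3 (periodsT3 F K)) =>
      flat115 ((H1f F n K hnK.le c₀ cB a (DeltaPiSlotP F n K hnK.le c₀ cB a) U₀) (Pi.single y Z)) b') hCH (half_pos hδH) h133
  -- the (157) entry row at the auxiliary chart window `e := (10¹¹L⁶)⁻¹`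
  set e : ℝ := (10 ^ 11 * (F.L : ℝ) ^ 6)⁻¹ with he_def
  have he : 0 < e := by rw [he_def]; positivity
  have hWe' : 10 ^ 11 * (F.L : ℝ) ^ 6 * e ≤ 1 := by rw [he_def, mul_inv_cancel₀ (by positivity)]
  have hWe : 10 ^ 9 * (F.L : ℝ) ^ 2 * e ≤ 1 := by
    refine le_trans ?_ hWe'
    refine mul_le_mul_of_nonneg_right ?_ he.le
    have h4 : (1 : ℝ) ≤ (F.L : ℝ) ^ 4 := one_le_pow₀ hL1.le
    nlinarith [pow_pos hL0 2]
  have h157 := fun (B : PBond (F.P K) 0 → Matrix (Fin 2) (Fin 2) ℂ) (hB : ‖B‖ < e * eta F n K) (b₀ : PBond (F.P K) 0)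
      (δ : PBond (F.P K) 0 → Matrix (Fin 2) (Fin 2) ℂ) (hδ : ∀ b, b ≠ b₀ → δ b = 0) (c : PBond (F.P n) 0) =>
    norm_fderiv_CmapTwS_apply_le_of_regPr F hnK hρ he hWe hW12 hWe' hW16 U₀ hreg B hB b₀ δ hδ c
  have hg' : (0 : ℝ) ≤ 10 ^ 11 * (F.L : ℝ) ^ 5 * ((F.L : ℝ) ^ (K - n))⁻¹ := by positivity
  have hQ := sum_norm_avgHess_single_le_of_entry_row (h := hnK.le) hρ he hWe hW12 (mul_pos he (eta_pos F n K)) hg' U₀ hreg h157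
  -- duality
  have hΘ : (0 : ℝ) ≤ 3 * CH * (2 * (1 + 1 / (δH / 2))) ^ 3 * ((F.L : ℝ) ^ (K - n)) ^ 3 := by positivity
  have hq : (0 : ℝ) ≤ 6 * (10 ^ 11 * (F.L : ℝ) ^ 5 * ((F.L : ℝ) ^ (K - n))⁻¹) := by positivity
  have hrow := tjRow_of_regPr_column (h := hnK.le) (c₀ := c₀) (cB := cB) (a := a) hρ.le hΘ hq U₀ hreg hcol hsum hQ X s hX bd
  have hη : eta F n K = ((F.L : ℝ) ^ (K - n))⁻¹ := by
    show ((F.L : ℝ)⁻¹) ^ (K - n) = _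
    rw [inv_pow]
  have e2 : 1 / (δH / 2) = 2 / δH := by rw [one_div_div]
  rw [hη, e2] at hrow
  refine hrow.trans (le_of_eq ?_)
  have hℓne : (F.L : ℝ) ^ (K - n) ≠ 0 := hℓ.ne'
  have hδne : δH ≠ 0 := hδH.ne'
  field_simp
  ring

end Member

/-! ## §2 The families in the K-storey thread -/

section Family

/-- ★★★ **THE J-TERM's VALUE ROWS FOR ALL MEMBERS FROM `h133` ALONE, L-ONLY CONSTANTS, K-STOREY THREAD.**  For positive L-only weights `c₀ cB`, a coupling window `[a₀, a₁]`, and the Π-slot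
kernel row family `h133` (px10's ✓`Prop7H133FamilyPackage.h133_family_exists` member block VERBATIM, letters `αH CH δH`), THERE ARE `αT MT : ℕ → ℝ` (cap with the four windows of record
and `≤ 1`, `0 ≤ MT L`) such that for every `L > 1`, member `i`, background `U₀` with `RegPr ρ U₀`, `ρ ≤ αT L`, under `Lift`, ROOM and the coupling window: (T-sup-lin) for every radius
`0 ≤ ρ′ ≤ αT L` with `RegPr ρ′ U₀`, the sup row of `T_Jᴾ_a(U₀)` with constant `ρ′·MT L`; (Tw-lin)∕(Tb-lin) E1's weighted ∕ E2's block-supported value letter at EVERY rate `δ ≥ 0` and EVERY radius `0 < ρ′ ≤ αT L` with `RegPr ρ′ U₀`, constant `ρ′·MT L·e^{δ}`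
(LINEAR in the radius — the cone windows downstream close by a cap).  NO letter displayed beyond `h133` (✓p776003).
[cite: Balaban1985BackgroundPropagators, (3.137) p.423, (3.127)–(3.128) p.421, (3.133) p.422; Balaban1985Averaging, Prop. 5 (157) p.42; Balaban1985Variational, (27)–(28) p.282, Thm 1 p.279] -/
theorem tjValueRows_family_of_h133 [hFL : ∀ F : T3Family, Fact (0 < (F.L : ℝ))] [hFη : ∀ (F : T3Family) (k : ℕ), Fact (0 < ((F.L : ℝ)⁻¹) ^ k)]
    (c₀ cB : ℕ → ℝ) [hc₀ : ∀ L : ℕ, Fact (0 < c₀ L)] [hcB : ∀ L : ℕ, Fact (0 < cB L)] {a₀ a₁ : ℝ}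
    (αH CH δH : ℕ → ℝ) (hαH : ∀ L : ℕ, 1 < L → 0 < αH L) (hWH12 : ∀ L : ℕ, 1 < L → 10 ^ 12 * (L : ℝ) ^ 3 * αH L ≤ 1) (hWH10 : ∀ L : ℕ, 1 < L → 10 ^ 10 * (L : ℝ) ^ 6 * αH L ≤ 1)
    (hWH13 : ∀ L : ℕ, 1 < L → 13 * 10 ^ 14 * (L : ℝ) ^ 3 * αH L ≤ 1) (hCH : ∀ L : ℕ, 1 < L → 0 ≤ CH L) (hδH : ∀ L : ℕ, 1 < L → 0 < δH L)
    (h133 : ∀ (L : ℕ), 1 < L → ∀ (i : Idx L) (U₀ : GaugeField (i.1.1.P i.1.2.2) 0 (Matrix.specialUnitaryGroup (Fin 2) ℂ)), ∀ ρ : ℝ, RegPr i.1.1 i.1.2.1 i.1.2.2 ρ U₀ → ρ ≤ αH L →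
        (∀ cf : Site (i.1.1.P i.1.2.2) (i.1.2.2 - i.1.2.1) → Matrix (Fin 2) (Fin 2) ℂ,
        (∀ e' : PBond (i.1.1.P i.1.2.2) (i.1.2.2 - i.1.2.1), cf e'.src = ((emlIterU (i.1.2.2 - i.1.2.1) (bgUnits i.1.1 i.1.2.2 U₀) e' : (Matrix (Fin 2) (Fin 2) ℂ)ˣ) : Matrix (Fin 2) (Fin 2) ℂ) * cf e'.tgt *
        (((emlIterU (i.1.2.2 - i.1.2.1) (bgUnits i.1.1 i.1.2.2 U₀) e')⁻¹ : (Matrix (Fin 2) (Fin 2) ℂ)ˣ) : Matrix (Fin 2) (Fin 2) ℂ)) →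
        ∃ l₀ : Site (i.1.1.P i.1.2.2) 0 → Matrix (Fin 2) (Fin 2) ℂ,
        (∀ b' : PBond (i.1.1.P i.1.2.2) 0, l₀ b'.src = ((bgUnits i.1.1 i.1.2.2 U₀ b' : (Matrix (Fin 2) (Fin 2) ℂ)ˣ) : Matrix (Fin 2) (Fin 2) ℂ) * l₀ b'.tgt * (((bgUnits i.1.1 i.1.2.2 U₀ b')⁻¹ : (Matrix (Fin 2) (Fin 2) ℂ)ˣ) : Matrix (Fin 2) (Fin 2) ℂ)) ∧
        ∀ y : Site (i.1.1.P i.1.2.2) (i.1.2.2 - i.1.2.1), l₀ (embIter (i.1.2.2 - i.1.2.1) y) = cf y) →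
      2 * (12 * i.1.1.L ^ (i.1.2.2 - i.1.2.1) + 5) ≤ (i.1.1.P i.1.2.2).sitesPerDir 0 →
      ∀ a : ℝ, a₀ * (c₀ L / cB L) * ((i.1.1.L : ℝ) ^ (i.1.2.2 - i.1.2.1)) ^ 3 ≤ a → a ≤ a₁ * (c₀ L / cB L) * ((i.1.1.L : ℝ) ^ (i.1.2.2 - i.1.2.1)) ^ 3 →
      ∀ (y : PBond (i.1.1.P i.1.2.1) 0) (Z : Matrix (Fin 2) (Fin 2) ℂ) (b' : Bond 3 (periodsT3 i.1.1 i.1.2.2)),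
        ‖flat115 ((H1f i.1.1 i.1.2.1 i.1.2.2 i.2.2.le (c₀ L) (cB L) a (DeltaPiSlotP i.1.1 i.1.2.1 i.1.2.2 i.2.2.le (c₀ L) (cB L) a) U₀) (Pi.single y Z)) b'‖
          ≤ CH L * Real.exp (-(δH L / 2 * (Site.tdist (B5Eq118OneStroke.iterBlockOf (i.1.2.2 - i.1.2.1) ((bondEquiv i.1.1 i.1.2.2).symm b').src)
              (T3LevelShift.siteShift (T3PrintedRegularOrbits.sites_eq i.1.1 i.1.2.1 i.1.2.2 i.2.2.le) y.src) : ℝ))) * ‖Z‖)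
    :
    ∃ (αT MT : ℕ → ℝ),
      (∀ L : ℕ, 1 < L → 0 < αT L) ∧ (∀ L : ℕ, 1 < L → 10 ^ 12 * (L : ℝ) ^ 3 * αT L ≤ 1) ∧ (∀ L : ℕ, 1 < L → 10 ^ 10 * (L : ℝ) ^ 6 * αT L ≤ 1) ∧
      (∀ L : ℕ, 1 < L → 13 * 10 ^ 14 * (L : ℝ) ^ 3 * αT L ≤ 1) ∧ (∀ L : ℕ, 1 < L → 10 ^ 16 * (L : ℝ) ^ 5 * αT L ≤ 1) ∧ (∀ L : ℕ, 1 < L → αT L ≤ αH L) ∧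
      (∀ L : ℕ, 1 < L → αT L ≤ 1) ∧ (∀ L : ℕ, 1 < L → 0 ≤ MT L) ∧
    ∀ (L : ℕ), 1 < L → ∀ (i : Idx L) (U₀ : GaugeField (i.1.1.P i.1.2.2) 0 (Matrix.specialUnitaryGroup (Fin 2) ℂ)), ∀ ρ : ℝ, RegPr i.1.1 i.1.2.1 i.1.2.2 ρ U₀ → ρ ≤ αT L →
        (∀ cf : Site (i.1.1.P i.1.2.2) (i.1.2.2 - i.1.2.1) → Matrix (Fin 2) (Fin 2) ℂ,
        (∀ e' : PBond (i.1.1.P i.1.2.2) (i.1.2.2 - i.1.2.1), cf e'.src = ((emlIterU (i.1.2.2 - i.1.2.1) (bgUnits i.1.1 i.1.2.2 U₀) e' : (Matrix (Fin 2) (Fin 2) ℂ)ˣ) : Matrix (Fin 2) (Fin 2) ℂ) * cf e'.tgt *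
        (((emlIterU (i.1.2.2 - i.1.2.1) (bgUnits i.1.1 i.1.2.2 U₀) e')⁻¹ : (Matrix (Fin 2) (Fin 2) ℂ)ˣ) : Matrix (Fin 2) (Fin 2) ℂ)) →
        ∃ l₀ : Site (i.1.1.P i.1.2.2) 0 → Matrix (Fin 2) (Fin 2) ℂ,
        (∀ b' : PBond (i.1.1.P i.1.2.2) 0, l₀ b'.src = ((bgUnits i.1.1 i.1.2.2 U₀ b' : (Matrix (Fin 2) (Fin 2) ℂ)ˣ) : Matrix (Fin 2) (Fin 2) ℂ) * l₀ b'.tgt * (((bgUnits i.1.1 i.1.2.2 U₀ b')⁻¹ : (Matrix (Fin 2) (Fin 2) ℂ)ˣ) : Matrix (Fin 2) (Fin 2) ℂ)) ∧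
        ∀ y : Site (i.1.1.P i.1.2.2) (i.1.2.2 - i.1.2.1), l₀ (embIter (i.1.2.2 - i.1.2.1) y) = cf y) →
      2 * (12 * i.1.1.L ^ (i.1.2.2 - i.1.2.1) + 5) ≤ (i.1.1.P i.1.2.2).sitesPerDir 0 →
      ∀ a : ℝ, a₀ * (c₀ L / cB L) * ((i.1.1.L : ℝ) ^ (i.1.2.2 - i.1.2.1)) ^ 3 ≤ a → a ≤ a₁ * (c₀ L / cB L) * ((i.1.1.L : ℝ) ^ (i.1.2.2 - i.1.2.1)) ^ 3 →
      -- (T-sup-lin) the sup row of `T_Jᴾ`, linear in the radius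
      (∀ ρ' : ℝ, 0 ≤ ρ' → ρ' ≤ αT L → RegPr i.1.1 i.1.2.1 i.1.2.2 ρ' U₀ →
        ∀ (X : PBond (i.1.1.P i.1.2.2) 0 → Matrix (Fin 2) (Fin 2) ℂ) (s : ℝ), (∀ bd, ‖X bd‖ ≤ s) →
          ∀ bd : PBond (i.1.1.P i.1.2.2) 0, ‖(toL2 i.1.1 i.1.2.2 (c₀ L)).symm (TJSlotP i.1.1 i.1.2.1 i.1.2.2 i.2.2.le (c₀ L) (cB L) a U₀ (toL2 i.1.1 i.1.2.2 (c₀ L) X)) bd‖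
            ≤ (ρ' * MT L) * s) ∧
      -- (Tw-lin) E1's weighted value letter of `T_Jᴾ`, every rate, linear in the radius
      (∀ ρ' : ℝ, 0 < ρ' → ρ' ≤ αT L → RegPr i.1.1 i.1.2.1 i.1.2.2 ρ' U₀ →
        ∀ δ : ℝ, 0 ≤ δ → ∀ (z : Site (i.1.1.P i.1.2.2) (i.1.2.2 - i.1.2.1)) (Y : PBond (i.1.1.P i.1.2.2) 0 → Matrix (Fin 2) (Fin 2) ℂ) (m : ℝ), 0 ≤ m →
        (∀ b, ‖Y b‖ ≤ m * Real.exp (-(δ * (Site.tdist (iterBlockOf (i.1.2.2 - i.1.2.1) b.src) z : ℝ)))) →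
        ∀ bd : PBond (i.1.1.P i.1.2.2) 0, ‖(toL2 i.1.1 i.1.2.2 (c₀ L)).symm (TJSlotP i.1.1 i.1.2.1 i.1.2.2 i.2.2.le (c₀ L) (cB L) a U₀ (toL2 i.1.1 i.1.2.2 (c₀ L) Y)) bd‖
          ≤ (ρ' * MT L * Real.exp δ) * m * Real.exp (-(δ * (Site.tdist (iterBlockOf (i.1.2.2 - i.1.2.1) bd.src) z : ℝ)))) ∧
      -- (Tb-lin) E2's block-supported value letter of `T_Jᴾ`, every rate, linear in the radius
      (∀ ρ' : ℝ, 0 < ρ' → ρ' ≤ αT L → RegPr i.1.1 i.1.2.1 i.1.2.2 ρ' U₀ →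
        ∀ δ : ℝ, 0 ≤ δ → ∀ (X : PBond (i.1.1.P i.1.2.2) 0 → Matrix (Fin 2) (Fin 2) ℂ) (z : Site (i.1.1.P i.1.2.2) (i.1.2.2 - i.1.2.1)),
        (∀ b, X b ≠ 0 → iterBlockOf (i.1.2.2 - i.1.2.1) b.src = z) → ∀ s : ℝ, 0 ≤ s → (∀ b, ‖X b‖ ≤ s) →
          ∀ bd : PBond (i.1.1.P i.1.2.2) 0, ‖(toL2 i.1.1 i.1.2.2 (c₀ L)).symm (TJSlotP i.1.1 i.1.2.1 i.1.2.2 i.2.2.le (c₀ L) (cB L) a U₀ (toL2 i.1.1 i.1.2.2 (c₀ L) X)) bd‖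
            ≤ s * (ρ' * MT L * Real.exp δ) * Real.exp (-(δ * (Site.tdist (P := i.1.1.P i.1.2.2) (iterBlockOf (i.1.2.2 - i.1.2.1) bd.src) z : ℝ)))) := by
  -- the L-only choices
  set αT : ℕ → ℝ := fun L => min (αH L) (min (10 ^ 16 * (L : ℝ) ^ 5)⁻¹ 1) with hαT
  set MT : ℕ → ℝ := fun L => 36 * 10 ^ 11 * (L : ℝ) ^ 5 * CH L * (2 * (1 + 2 / δH L)) ^ 3 with hMT
  have hαT0 : ∀ L : ℕ, 1 < L → 0 < αT L := fun L hL => by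
    have := hαH L hL
    have hL0 : (0 : ℝ) < L := by exact_mod_cast lt_trans zero_lt_one hL
    simp only [hαT]; exact lt_min (by assumption) (lt_min (by positivity) one_pos)
  have hTH : ∀ L, αT L ≤ αH L := fun L => by simp only [hαT]; exact min_le_left _ _
  have hT16 : ∀ L, αT L ≤ (10 ^ 16 * (L : ℝ) ^ 5)⁻¹ := fun L => by simp only [hαT]; exact (min_le_right _ _).trans (min_le_left _ _)
  have hT1 : ∀ L, αT L ≤ 1 := fun L => by simp only [hαT]; exact (min_le_right _ _).trans (min_le_right _ _)
  have hMT0 : ∀ L : ℕ, 1 < L → 0 ≤ MT L := fun L hL => by have := hCH L hL; have := hδH L hL; simp only [hMT]; positivity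
  refine ⟨αT, MT, hαT0, fun L hL => ?_, fun L hL => ?_, fun L hL => ?_, fun L hL => ?_, fun L _ => hTH L, fun L _ => hT1 L, hMT0, ?_⟩
  · exact (mul_le_mul_of_nonneg_left (hTH L) (by positivity)).trans (hWH12 L hL)
  · exact (mul_le_mul_of_nonneg_left (hTH L) (by positivity)).trans (hWH10 L hL)
  · exact (mul_le_mul_of_nonneg_left (hTH L) (by positivity)).trans (hWH13 L hL)
  · have hL0 : (0 : ℝ) < L := by exact_mod_cast lt_trans zero_lt_one hL
    have hpos : (0 : ℝ) < 10 ^ 16 * (L : ℝ) ^ 5 := by positivity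
    calc 10 ^ 16 * (L : ℝ) ^ 5 * αT L ≤ 10 ^ 16 * (L : ℝ) ^ 5 * (10 ^ 16 * (L : ℝ) ^ 5)⁻¹ := mul_le_mul_of_nonneg_left (hT16 L) hpos.le
      _ = 1 := mul_inv_cancel₀ hpos.ne'
  -- the member
  intro L hL i U₀ ρ hreg hρ hlift hroom a ha₀a ha₁a
  have hFL : (i.1.1.L : ℝ) = (L : ℝ) := by rw [i.2.1]
  have hL0 : (0 : ℝ) < L := by exact_mod_cast lt_trans zero_lt_one hL
  have hαL := hαT0 L hL; have hCHL := hCH L hL; have hδHL := hδH L hL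
  have hW12 : ∀ ρ' : ℝ, ρ' ≤ αT L → 10 ^ 12 * (i.1.1.L : ℝ) ^ 3 * ρ' ≤ 1 := fun ρ' hρ' => by
    rw [hFL]; exact (mul_le_mul_of_nonneg_left (hρ'.trans (hTH L)) (by positivity)).trans (hWH12 L hL)
  have hW16 : ∀ ρ' : ℝ, ρ' ≤ αT L → 10 ^ 16 * (i.1.1.L : ℝ) ^ 5 * ρ' ≤ 1 := fun ρ' hρ' => by
    rw [hFL]
    have hpos : (0 : ℝ) < 10 ^ 16 * (L : ℝ) ^ 5 := by positivity
    calc 10 ^ 16 * (L : ℝ) ^ 5 * ρ' ≤ 10 ^ 16 * (L : ℝ) ^ 5 * (10 ^ 16 * (L : ℝ) ^ 5)⁻¹ := mul_le_mul_of_nonneg_left (hρ'.trans (hT16 L)) hpos.le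
      _ = 1 := mul_inv_cancel₀ hpos.ne'
  have h133m := h133 L hL i U₀ ρ hreg (hρ.trans (hTH L)) hlift hroom a ha₀a ha₁a
  -- (T-sup) at a radius `0 < ρ' ≤ αT L` (§1 at the member)
  have hsup : ∀ ρ' : ℝ, 0 < ρ' → ρ' ≤ αT L → RegPr i.1.1 i.1.2.1 i.1.2.2 ρ' U₀ →
      ∀ (X : PBond (i.1.1.P i.1.2.2) 0 → Matrix (Fin 2) (Fin 2) ℂ) (s : ℝ), (∀ bd, ‖X bd‖ ≤ s) →
        ∀ bd : PBond (i.1.1.P i.1.2.2) 0, ‖(toL2 i.1.1 i.1.2.2 (c₀ L)).symm (TJSlotP i.1.1 i.1.2.1 i.1.2.2 i.2.2.le (c₀ L) (cB L) a U₀ (toL2 i.1.1 i.1.2.2 (c₀ L) X)) bd‖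
          ≤ (ρ' * MT L) * s := by
    intro ρ' hρ'0 hρ' hreg' X s hX bd
    have h := tjSupRow_of_h133 i.1.1 i.2.2 (c₀ L) (cB L) a hρ'0 (hW12 ρ' hρ') (hW16 ρ' hρ') U₀ hreg' hCHL hδHL h133m X s hX bd
    rw [hFL] at h
    simpa only [hMT] using h
  have hTw : ∀ ρ' : ℝ, 0 < ρ' → ρ' ≤ αT L → RegPr i.1.1 i.1.2.1 i.1.2.2 ρ' U₀ →
      ∀ δ : ℝ, 0 ≤ δ → ∀ (z : Site (i.1.1.P i.1.2.2) (i.1.2.2 - i.1.2.1)) (Y : PBond (i.1.1.P i.1.2.2) 0 → Matrix (Fin 2) (Fin 2) ℂ) (m : ℝ), 0 ≤ m →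
      (∀ b, ‖Y b‖ ≤ m * Real.exp (-(δ * (Site.tdist (iterBlockOf (i.1.2.2 - i.1.2.1) b.src) z : ℝ)))) →
      ∀ bd : PBond (i.1.1.P i.1.2.2) 0, ‖(toL2 i.1.1 i.1.2.2 (c₀ L)).symm (TJSlotP i.1.1 i.1.2.1 i.1.2.2 i.2.2.le (c₀ L) (cB L) a U₀ (toL2 i.1.1 i.1.2.2 (c₀ L) Y)) bd‖
        ≤ (ρ' * MT L * Real.exp δ) * m * Real.exp (-(δ * (Site.tdist (iterBlockOf (i.1.2.2 - i.1.2.1) bd.src) z : ℝ))) :=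
    fun ρ' hρ'0 hρ' hreg' δ hδ z Y m hm hY bd =>
      hTw_of_supRow i.1.1 i.2.2.le (c₀ L) (cB L) a hρ'0 (hW12 ρ' hρ') U₀ hreg' (hsup ρ' hρ'0 hρ' hreg') hδ z Y m hm hY bd
  refine ⟨fun ρ' hρ'0 hρ' hreg' X s hX bd => ?_, hTw, fun ρ' hρ'0 hρ' hreg' δ hδ => ?_⟩
  · -- (T-sup-lin): at a positive radius this is §1; at `ρ' = 0`, `RegPr 0 U₀ ⟹ RegPr t U₀` for every `t > 0` (✓`regPr_mono`), so the row holds with `t·MT L` for all small `t`; let `t ↓ 0`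
    rcases hρ'0.eq_or_lt with h0 | hpos
    · have key : ∀ t : ℝ, 0 < t → t ≤ αT L →
          ‖(toL2 i.1.1 i.1.2.2 (c₀ L)).symm (TJSlotP i.1.1 i.1.2.1 i.1.2.2 i.2.2.le (c₀ L) (cB L) a U₀ (toL2 i.1.1 i.1.2.2 (c₀ L) X)) bd‖ ≤ (t * MT L) * s :=
        fun t ht htα => hsup t ht htα (regPr_mono (F := i.1.1) (by rw [← h0]; exact ht.le) hreg') X s hX bd
      rw [← h0, zero_mul, zero_mul]
      refine le_of_forall_pos_le_add fun ε hε => ?_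
      rw [zero_add]
      by_cases hs : s ≤ 0
      · have h1 := key (αT L) hαL le_rfl
        have : (αT L * MT L) * s ≤ 0 := mul_nonpos_of_nonneg_of_nonpos (mul_nonneg hαL.le (hMT0 L hL)) hs
        linarith
      · push Not at hs
        by_cases hM : MT L = 0
        · have h1 := key (αT L) hαL le_rfl; rw [hM, mul_zero, zero_mul] at h1; linarith
        · have hMpos : 0 < MT L := lt_of_le_of_ne (hMT0 L hL) (Ne.symm hM)
          set t : ℝ := min (αT L) (ε / (MT L * s)) with ht
          have htpos : 0 < t := lt_min hαL (div_pos hε (mul_pos hMpos hs))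
          have h1 := key t htpos (min_le_left _ _)
          calc _ ≤ (t * MT L) * s := h1
            _ ≤ (ε / (MT L * s) * MT L) * s := by gcongr; exact min_le_right _ _
            _ = ε := by field_simp
    · exact hsup ρ' hpos hρ' hreg' X s hX bd
  · exact blockLetter_of_weightedLetter (fun b : PBond (i.1.1.P i.1.2.2) 0 => iterBlockOf (i.1.2.2 - i.1.2.1) b.src)
      (fun bd : PBond (i.1.1.P i.1.2.2) 0 => iterBlockOf (i.1.2.2 - i.1.2.1) bd.src)
      (fun Y bd => (toL2 i.1.1 i.1.2.2 (c₀ L)).symm (TJSlotP i.1.1 i.1.2.1 i.1.2.2 i.2.2.le (c₀ L) (cB L) a U₀ (toL2 i.1.1 i.1.2.2 (c₀ L) Y)) bd) (hTw ρ' hρ'0 hρ' hreg' δ hδ)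

/-- ★★★ **THE J-TERM's DIVERGENCE ROWS FOR ALL MEMBERS FROM `h133` AND THE DISPLAYED GAUGE-SPIKE HESSIAN ROW `hqG`, L-ONLY CONSTANTS, K-STOREY THREAD.**  Same `h133` letters, plus px19's
`hqG` family (✓`Prop7AvgHessGaugeIdentityNormReading.hqG_of_pointwise_identity_and_FR2_family` conclusion VERBATIM, letters `αq qG` — DISPLAYED, its suppliers are ⟨(2) pointwise, FR₂-lite⟩):
THERE ARE `αD MD : ℕ → ℝ` (cap with the four windows, `αD ≤ αH`, `αD ≤ αq`, `≤ 1`; `0 ≤ MD L`) such that at every member under the thread with `ρ ≤ αD L`: (TDw-lin) E1's weighted divergence letter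
of `T_Jᴾ_a(U₀)` at EVERY rate `δ ≥ 0` and radius `0 < ρ′ ≤ αD L` with constant `ρ′·MD L·e^{δ}`, and (TDb-lin) E2's block-supported divergence letter likewise (`MD := 6·CH·(2(1+2∕δH))³·qG`; `ℓ³·ℓ⁻¹·η² = 1`).
[cite: Balaban1985BackgroundPropagators, (3.137) p.423, (3.127)–(3.128) p.421, (3.133) p.422, (3.114)–(3.115) p.418; Balaban1985Averaging, Prop. 5 (157) p.42; Balaban1985Variational, (27)–(28) p.282] -/
theorem tjDivRows_family_of_h133_hqG [hFL : ∀ F : T3Family, Fact (0 < (F.L : ℝ))] [hFη : ∀ (F : T3Family) (k : ℕ), Fact (0 < ((F.L : ℝ)⁻¹) ^ k)]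
    (c₀ cB : ℕ → ℝ) [hc₀ : ∀ L : ℕ, Fact (0 < c₀ L)] [hcB : ∀ L : ℕ, Fact (0 < cB L)] {a₀ a₁ : ℝ}
    (αH CH δH : ℕ → ℝ) (hαH : ∀ L : ℕ, 1 < L → 0 < αH L) (hWH12 : ∀ L : ℕ, 1 < L → 10 ^ 12 * (L : ℝ) ^ 3 * αH L ≤ 1) (hWH10 : ∀ L : ℕ, 1 < L → 10 ^ 10 * (L : ℝ) ^ 6 * αH L ≤ 1)
    (hWH13 : ∀ L : ℕ, 1 < L → 13 * 10 ^ 14 * (L : ℝ) ^ 3 * αH L ≤ 1) (hCH : ∀ L : ℕ, 1 < L → 0 ≤ CH L) (hδH : ∀ L : ℕ, 1 < L → 0 < δH L)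
    (h133 : ∀ (L : ℕ), 1 < L → ∀ (i : Idx L) (U₀ : GaugeField (i.1.1.P i.1.2.2) 0 (Matrix.specialUnitaryGroup (Fin 2) ℂ)), ∀ ρ : ℝ, RegPr i.1.1 i.1.2.1 i.1.2.2 ρ U₀ → ρ ≤ αH L →
        (∀ cf : Site (i.1.1.P i.1.2.2) (i.1.2.2 - i.1.2.1) → Matrix (Fin 2) (Fin 2) ℂ,
        (∀ e' : PBond (i.1.1.P i.1.2.2) (i.1.2.2 - i.1.2.1), cf e'.src = ((emlIterU (i.1.2.2 - i.1.2.1) (bgUnits i.1.1 i.1.2.2 U₀) e' : (Matrix (Fin 2) (Fin 2) ℂ)ˣ) : Matrix (Fin 2) (Fin 2) ℂ) * cf e'.tgt *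
        (((emlIterU (i.1.2.2 - i.1.2.1) (bgUnits i.1.1 i.1.2.2 U₀) e')⁻¹ : (Matrix (Fin 2) (Fin 2) ℂ)ˣ) : Matrix (Fin 2) (Fin 2) ℂ)) →
        ∃ l₀ : Site (i.1.1.P i.1.2.2) 0 → Matrix (Fin 2) (Fin 2) ℂ,
        (∀ b' : PBond (i.1.1.P i.1.2.2) 0, l₀ b'.src = ((bgUnits i.1.1 i.1.2.2 U₀ b' : (Matrix (Fin 2) (Fin 2) ℂ)ˣ) : Matrix (Fin 2) (Fin 2) ℂ) * l₀ b'.tgt * (((bgUnits i.1.1 i.1.2.2 U₀ b')⁻¹ : (Matrix (Fin 2) (Fin 2) ℂ)ˣ) : Matrix (Fin 2) (Fin 2) ℂ)) ∧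
        ∀ y : Site (i.1.1.P i.1.2.2) (i.1.2.2 - i.1.2.1), l₀ (embIter (i.1.2.2 - i.1.2.1) y) = cf y) →
      2 * (12 * i.1.1.L ^ (i.1.2.2 - i.1.2.1) + 5) ≤ (i.1.1.P i.1.2.2).sitesPerDir 0 →
      ∀ a : ℝ, a₀ * (c₀ L / cB L) * ((i.1.1.L : ℝ) ^ (i.1.2.2 - i.1.2.1)) ^ 3 ≤ a → a ≤ a₁ * (c₀ L / cB L) * ((i.1.1.L : ℝ) ^ (i.1.2.2 - i.1.2.1)) ^ 3 →
      ∀ (y : PBond (i.1.1.P i.1.2.1) 0) (Z : Matrix (Fin 2) (Fin 2) ℂ) (b' : Bond 3 (periodsT3 i.1.1 i.1.2.2)),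
        ‖flat115 ((H1f i.1.1 i.1.2.1 i.1.2.2 i.2.2.le (c₀ L) (cB L) a (DeltaPiSlotP i.1.1 i.1.2.1 i.1.2.2 i.2.2.le (c₀ L) (cB L) a) U₀) (Pi.single y Z)) b'‖
          ≤ CH L * Real.exp (-(δH L / 2 * (Site.tdist (B5Eq118OneStroke.iterBlockOf (i.1.2.2 - i.1.2.1) ((bondEquiv i.1.1 i.1.2.2).symm b').src)
              (T3LevelShift.siteShift (T3PrintedRegularOrbits.sites_eq i.1.1 i.1.2.1 i.1.2.2 i.2.2.le) y.src) : ℝ))) * ‖Z‖)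
    (αq qG : ℕ → ℝ) (hαq : ∀ L : ℕ, 1 < L → 0 < αq L) (hqG : ∀ L : ℕ, 1 < L → 0 ≤ qG L)
    (hqGrow : ∀ (L : ℕ), 1 < L → ∀ (i : Idx L) (U₀ : GaugeField (i.1.1.P i.1.2.2) 0 (Matrix.specialUnitaryGroup (Fin 2) ℂ)), RegPr i.1.1 i.1.2.1 i.1.2.2 (αq L) U₀ →
      ∀ (X' : PBond (i.1.1.P i.1.2.2) 0 → Matrix (Fin 2) (Fin 2) ℂ) (s : ℝ) (x : Site (i.1.1.P i.1.2.2) 0) (A : Matrix (Fin 2) (Fin 2) ℂ), (∀ b, ‖X' b‖ ≤ s) →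
        ∑ y : PBond (i.1.1.P i.1.2.1) 0, ‖avgHess i.1.1 i.1.2.1 i.1.2.2 i.2.2.le U₀ X'
            ((toL2 i.1.1 i.1.2.2 (c₀ L)).symm (DL2 i.1.1 i.1.2.1 i.1.2.2 (c₀ L) U₀ (toL2S i.1.1 i.1.2.2 (c₀ L) (Pi.single x A)))) y‖
          ≤ qG L * ((L : ℝ) ^ (i.1.2.2 - i.1.2.1))⁻¹ * s * ‖A‖) :
    ∃ (αD MD : ℕ → ℝ),
      (∀ L : ℕ, 1 < L → 0 < αD L) ∧ (∀ L : ℕ, 1 < L → 10 ^ 12 * (L : ℝ) ^ 3 * αD L ≤ 1) ∧ (∀ L : ℕ, 1 < L → 10 ^ 10 * (L : ℝ) ^ 6 * αD L ≤ 1) ∧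
      (∀ L : ℕ, 1 < L → 13 * 10 ^ 14 * (L : ℝ) ^ 3 * αD L ≤ 1) ∧ (∀ L : ℕ, 1 < L → αD L ≤ αH L) ∧ (∀ L : ℕ, 1 < L → αD L ≤ αq L) ∧
      (∀ L : ℕ, 1 < L → αD L ≤ 1) ∧ (∀ L : ℕ, 1 < L → 0 ≤ MD L) ∧
    ∀ (L : ℕ), 1 < L → ∀ (i : Idx L) (U₀ : GaugeField (i.1.1.P i.1.2.2) 0 (Matrix.specialUnitaryGroup (Fin 2) ℂ)), ∀ ρ : ℝ, RegPr i.1.1 i.1.2.1 i.1.2.2 ρ U₀ → ρ ≤ αD L →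
        (∀ cf : Site (i.1.1.P i.1.2.2) (i.1.2.2 - i.1.2.1) → Matrix (Fin 2) (Fin 2) ℂ,
        (∀ e' : PBond (i.1.1.P i.1.2.2) (i.1.2.2 - i.1.2.1), cf e'.src = ((emlIterU (i.1.2.2 - i.1.2.1) (bgUnits i.1.1 i.1.2.2 U₀) e' : (Matrix (Fin 2) (Fin 2) ℂ)ˣ) : Matrix (Fin 2) (Fin 2) ℂ) * cf e'.tgt *
        (((emlIterU (i.1.2.2 - i.1.2.1) (bgUnits i.1.1 i.1.2.2 U₀) e')⁻¹ : (Matrix (Fin 2) (Fin 2) ℂ)ˣ) : Matrix (Fin 2) (Fin 2) ℂ)) →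
        ∃ l₀ : Site (i.1.1.P i.1.2.2) 0 → Matrix (Fin 2) (Fin 2) ℂ,
        (∀ b' : PBond (i.1.1.P i.1.2.2) 0, l₀ b'.src = ((bgUnits i.1.1 i.1.2.2 U₀ b' : (Matrix (Fin 2) (Fin 2) ℂ)ˣ) : Matrix (Fin 2) (Fin 2) ℂ) * l₀ b'.tgt * (((bgUnits i.1.1 i.1.2.2 U₀ b')⁻¹ : (Matrix (Fin 2) (Fin 2) ℂ)ˣ) : Matrix (Fin 2) (Fin 2) ℂ)) ∧
        ∀ y : Site (i.1.1.P i.1.2.2) (i.1.2.2 - i.1.2.1), l₀ (embIter (i.1.2.2 - i.1.2.1) y) = cf y) →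
      2 * (12 * i.1.1.L ^ (i.1.2.2 - i.1.2.1) + 5) ≤ (i.1.1.P i.1.2.2).sitesPerDir 0 →
      ∀ a : ℝ, a₀ * (c₀ L / cB L) * ((i.1.1.L : ℝ) ^ (i.1.2.2 - i.1.2.1)) ^ 3 ≤ a → a ≤ a₁ * (c₀ L / cB L) * ((i.1.1.L : ℝ) ^ (i.1.2.2 - i.1.2.1)) ^ 3 →
      -- (TDw-lin) E1's weighted divergence letter of `T_Jᴾ`, every rate, linear in the radius
      (∀ ρ' : ℝ, 0 < ρ' → ρ' ≤ αD L → RegPr i.1.1 i.1.2.1 i.1.2.2 ρ' U₀ →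
        ∀ δ : ℝ, 0 ≤ δ → ∀ (z : Site (i.1.1.P i.1.2.2) (i.1.2.2 - i.1.2.1)) (Y : PBond (i.1.1.P i.1.2.2) 0 → Matrix (Fin 2) (Fin 2) ℂ) (m : ℝ), 0 ≤ m →
        (∀ b, ‖Y b‖ ≤ m * Real.exp (-(δ * (Site.tdist (iterBlockOf (i.1.2.2 - i.1.2.1) b.src) z : ℝ)))) →
        ∀ x : Site (i.1.1.P i.1.2.2) 0, ‖(toL2S i.1.1 i.1.2.2 (c₀ L)).symm (DstarL2 i.1.1 i.1.2.1 i.1.2.2 (c₀ L) U₀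
            (TJSlotP i.1.1 i.1.2.1 i.1.2.2 i.2.2.le (c₀ L) (cB L) a U₀ (toL2 i.1.1 i.1.2.2 (c₀ L) Y))) x‖
          ≤ (ρ' * MD L * Real.exp δ) * m * Real.exp (-(δ * (Site.tdist (iterBlockOf (i.1.2.2 - i.1.2.1) x) z : ℝ)))) ∧
      -- (TDb-lin) E2's block-supported divergence letter of `T_Jᴾ`, every rate, linear in the radius
      (∀ ρ' : ℝ, 0 < ρ' → ρ' ≤ αD L → RegPr i.1.1 i.1.2.1 i.1.2.2 ρ' U₀ →
        ∀ δ : ℝ, 0 ≤ δ → ∀ (X : PBond (i.1.1.P i.1.2.2) 0 → Matrix (Fin 2) (Fin 2) ℂ) (z : Site (i.1.1.P i.1.2.2) (i.1.2.2 - i.1.2.1)),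
        (∀ b, X b ≠ 0 → iterBlockOf (i.1.2.2 - i.1.2.1) b.src = z) → ∀ s : ℝ, 0 ≤ s → (∀ b, ‖X b‖ ≤ s) →
          ∀ x : Site (i.1.1.P i.1.2.2) 0, ‖(toL2S i.1.1 i.1.2.2 (c₀ L)).symm (DstarL2 i.1.1 i.1.2.1 i.1.2.2 (c₀ L) U₀
              (TJSlotP i.1.1 i.1.2.1 i.1.2.2 i.2.2.le (c₀ L) (cB L) a U₀ (toL2 i.1.1 i.1.2.2 (c₀ L) X))) x‖
            ≤ s * (ρ' * MD L * Real.exp δ) * Real.exp (-(δ * (Site.tdist (P := i.1.1.P i.1.2.2) (iterBlockOf (i.1.2.2 - i.1.2.1) x) z : ℝ)))) := by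
  -- the L-only choices
  set αD : ℕ → ℝ := fun L => min (min (αH L) (αq L)) 1 with hαD
  set MD : ℕ → ℝ := fun L => 6 * CH L * (2 * (1 + 2 / δH L)) ^ 3 * qG L with hMD
  have hαD0 : ∀ L : ℕ, 1 < L → 0 < αD L := fun L hL => by
    have := hαH L hL; have := hαq L hL
    simp only [hαD]; exact lt_min (lt_min (by assumption) (by assumption)) one_pos
  have hDH : ∀ L, αD L ≤ αH L := fun L => by simp only [hαD]; exact (min_le_left _ _).trans (min_le_left _ _)
  have hDq : ∀ L, αD L ≤ αq L := fun L => by simp only [hαD]; exact (min_le_left _ _).trans (min_le_right _ _)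
  have hD1 : ∀ L, αD L ≤ 1 := fun L => by simp only [hαD]; exact min_le_right _ _
  have hMD0 : ∀ L : ℕ, 1 < L → 0 ≤ MD L := fun L hL => by have := hCH L hL; have := hδH L hL; have := hqG L hL; simp only [hMD]; positivity
  refine ⟨αD, MD, hαD0, fun L hL => ?_, fun L hL => ?_, fun L hL => ?_, fun L _ => hDH L, fun L _ => hDq L, fun L _ => hD1 L, hMD0, ?_⟩
  · exact (mul_le_mul_of_nonneg_left (hDH L) (by positivity)).trans (hWH12 L hL)
  · exact (mul_le_mul_of_nonneg_left (hDH L) (by positivity)).trans (hWH10 L hL)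
  · exact (mul_le_mul_of_nonneg_left (hDH L) (by positivity)).trans (hWH13 L hL)
  -- the member
  intro L hL i U₀ ρ hreg hρ hlift hroom a ha₀a ha₁a
  have hFL : (i.1.1.L : ℝ) = (L : ℝ) := by rw [i.2.1]
  have hL0 : (0 : ℝ) < L := by exact_mod_cast lt_trans zero_lt_one hL
  have hℓ : (0 : ℝ) < (L : ℝ) ^ (i.1.2.2 - i.1.2.1) := pow_pos hL0 _
  have hCHL := hCH L hL; have hδHL := hδH L hL; have hqGL := hqG L hL
  have hW12 : ∀ ρ' : ℝ, ρ' ≤ αD L → 10 ^ 12 * (i.1.1.L : ℝ) ^ 3 * ρ' ≤ 1 := fun ρ' hρ' => by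
    rw [hFL]; exact (mul_le_mul_of_nonneg_left (hρ'.trans (hDH L)) (by positivity)).trans (hWH12 L hL)
  have h133m := h133 L hL i U₀ ρ hreg (hρ.trans (hDH L)) hlift hroom a ha₀a ha₁a
  obtain ⟨hk, -, hcol, hsum⟩ := column_row_of_kernel_decay i.1.1 i.1.2.1 i.1.2.2 i.2.2.le
    (fun (y : PBond (i.1.1.P i.1.2.1) 0) (Z : Matrix (Fin 2) (Fin 2) ℂ) (b' : Bond 3 (periodsT3 i.1.1 i.1.2.2)) =>
      flat115 ((H1f i.1.1 i.1.2.1 i.1.2.2 i.2.2.le (c₀ L) (cB L) a (DeltaPiSlotP i.1.1 i.1.2.1 i.1.2.2 i.2.2.le (c₀ L) (cB L) a) U₀) (Pi.single y Z)) b') hCHL (half_pos hδHL) h133m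
  have hregq : RegPr i.1.1 i.1.2.1 i.1.2.2 (αq L) U₀ := regPr_mono (F := i.1.1) (hρ.trans (hDq L)) hreg
  have hQG := hqGrow L hL i U₀ hregq
  have hΘ : (0 : ℝ) ≤ 3 * CH L * (2 * (1 + 1 / (δH L / 2))) ^ 3 * ((i.1.1.L : ℝ) ^ (i.1.2.2 - i.1.2.1)) ^ 3 := by positivity
  have hqG' : (0 : ℝ) ≤ qG L * ((L : ℝ) ^ (i.1.2.2 - i.1.2.1))⁻¹ := by positivity
  have hTDw : ∀ ρ' : ℝ, 0 < ρ' → ρ' ≤ αD L → RegPr i.1.1 i.1.2.1 i.1.2.2 ρ' U₀ →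
      ∀ δ : ℝ, 0 ≤ δ → ∀ (z : Site (i.1.1.P i.1.2.2) (i.1.2.2 - i.1.2.1)) (Y : PBond (i.1.1.P i.1.2.2) 0 → Matrix (Fin 2) (Fin 2) ℂ) (m : ℝ), 0 ≤ m →
      (∀ b, ‖Y b‖ ≤ m * Real.exp (-(δ * (Site.tdist (iterBlockOf (i.1.2.2 - i.1.2.1) b.src) z : ℝ)))) →
      ∀ x : Site (i.1.1.P i.1.2.2) 0, ‖(toL2S i.1.1 i.1.2.2 (c₀ L)).symm (DstarL2 i.1.1 i.1.2.1 i.1.2.2 (c₀ L) U₀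
          (TJSlotP i.1.1 i.1.2.1 i.1.2.2 i.2.2.le (c₀ L) (cB L) a U₀ (toL2 i.1.1 i.1.2.2 (c₀ L) Y))) x‖
        ≤ (ρ' * MD L * Real.exp δ) * m * Real.exp (-(δ * (Site.tdist (iterBlockOf (i.1.2.2 - i.1.2.1) x) z : ℝ))) := by
    intro ρ' hρ'0 hρ' hreg' δ hδ z Y m hm hY x
    have h := hTDw_of_regPr_column (h := i.2.2.le) (c₀ := c₀ L) (cB := cB L) (a := a) hρ'0 (hW12 ρ' hρ') hΘ hqG' U₀ hreg' hcol hsum hQG hδ z Y m hm hY x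
    have hη : eta i.1.1 i.1.2.1 i.1.2.2 = ((L : ℝ) ^ (i.1.2.2 - i.1.2.1))⁻¹ := by
      show ((i.1.1.L : ℝ)⁻¹) ^ (i.1.2.2 - i.1.2.1) = _
      rw [hFL, inv_pow]
    have e2 : 1 / (δH L / 2) = 2 / δH L := by rw [one_div_div]
    rw [hη, e2, hFL] at h
    refine h.trans (le_of_eq ?_)
    have hℓne : (L : ℝ) ^ (i.1.2.2 - i.1.2.1) ≠ 0 := hℓ.ne'
    have hδne : δH L ≠ 0 := hδHL.ne'
    simp only [hMD]
    field_simp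
    ring
  refine ⟨hTDw, fun ρ' hρ'0 hρ' hreg' δ hδ => ?_⟩
  exact blockLetter_of_weightedLetter (fun b : PBond (i.1.1.P i.1.2.2) 0 => iterBlockOf (i.1.2.2 - i.1.2.1) b.src)
    (fun x : Site (i.1.1.P i.1.2.2) 0 => iterBlockOf (i.1.2.2 - i.1.2.1) x)
    (fun Y x => (toL2S i.1.1 i.1.2.2 (c₀ L)).symm (DstarL2 i.1.1 i.1.2.1 i.1.2.2 (c₀ L) U₀
      (TJSlotP i.1.1 i.1.2.1 i.1.2.2 i.2.2.le (c₀ L) (cB L) a U₀ (toL2 i.1.1 i.1.2.2 (c₀ L) Y))) x) (hTDw ρ' hρ'0 hρ' hreg' δ hδ)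

end Family

end Summit.QuantumFields.YangMills.Theorems.Prop7TJRowsFamilyOfH133

end
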